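import Literature.MathematicalPhysics.QuantumLattice.DWaveOrderParameterInfiniteVolume
import Literature.MathematicalPhysics.QuantumLattice.DWaveSourceEnergyDensityEnsembles
import HarnessLib

/-!
# Infinite-volume reading of the pinning-field dictionary, II: the `d`-wave order parameter IS the largest
# `d`-wave pair amplitude of a translation-invariant infinite-volume ground state — and it is attained
# (Koma–Tasaki's quasi-average state); diagonal vanishing-source sequences

Topic `Literature/MathematicalPhysics/QuantumLattice` (namespace = path). Sequel of
`DWaveOrderParameterInfiniteVolume.lean` (hubbard-cq-p5: bridge `tiGroundEnergyDensity = e_src`,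
`m* = −∂⁺E(0)/2`, range / attainment / uniqueness of the pair amplitude of translation-invariant sourced
ground states at a field `h`). Hubbard cuprate cell (`hubbard-cq`), rung CQ, rows PC-a / PC-c; both anchors
(`t'` is a parameter; `t' = 0` forms through `dWaveOrderParameterTT'_zero`). Everything is PROVED; no
definition, no named fact, zero compute.

## Contents (`E(h) := dWaveSourceEnergyDensityTT' t' U μ h`, `m* := dWaveOrderParameterTT' t' U μ`,
`P₀^d := localPairAt ({0} ∪ unitSteps) dWaveFormFactor 0`; "ground state" = Bratteli–Kishimoto–Robinson
mean-energy minimiser of the grand-canonical `t–t'` Hubbard interaction `hubbardTTPrimeMuInteraction 1 t' U μ`)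

* §4 AT ZERO FIELD — **the quasi-average state**: every translation-invariant ground state `ω` has
  `Re ω(P₀^d) ≤ m*` (`IsMeanEnergyMinimiser.re_expect_localPairAt_le_dWaveOrderParameterTT'`) and
  `−∂⁻E(0) ≤ 2 Re ω(P₀^d)`; some translation-invariant ground state ATTAINS `Re ω(P₀^d) = m*`
  (`exists_isMeanEnergyMinimiser_re_expect_localPairAt_eq_dWaveOrderParameterTT'`: the weak-⋆ limit
  `h → 0⁺` of sourced translation-invariant ground states AFTER `L → ∞`, Koma–Tasaki 1994 §1/§2.4);
  `isGreatest_…`; and **`hasDWaveOrderTT'_iff_exists_isMeanEnergyMinimiser`: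
  `HasDWaveOrderTT' t' U μ ↔` some translation-invariant infinite-volume ground state has `Re ω(P₀^d) > 0`**
  (`t' = 0`: `hasDWaveOrder_iff_exists_isMeanEnergyMinimiser`,
  `isGreatest_re_expect_localPairAt_groundStates_dWaveOrderParameter`). The cell's T2 word made literal:
  "an infinite-volume ground state with non-zero `d`-wave order parameter exists".
* §4b TORUS LIMITS: torus limits of unit ground-state vectors of `dWaveSourceTorusTT' L t' U μ h` are
  mean-energy minimisers of the sourced interaction (obsth-2's `IsTorusLimitOf.isMeanEnergyMinimiser_sourced`,
  `DWaveSourceEnergyDensityEnsembles.lean` — which also holds the bridge `e_src = tiGroundEnergyDensity`,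
  duplicated by name in part I), so all of the above applies to thermodynamic limits of finite-volume ground
  states; at `h = 0`: `IsTorusLimitOf.re_expect_localPairAt_le_dWaveOrderParameterTT'`.
* §5 DIAGONAL (vanishing-source) sequences (hubbard-pc-lens-finite-1's lemma, adopted): a floor on the sourced
  torus density along ANY positive sequence `h_L → 0` floors `m*`
  (`le_dWaveOrderParameterTT'_of_vanishing_source`, `le_dWaveOrderParameter_of_vanishing_source`,
  `le_dWaveOrderParameter_of_inverseSquare_source`): diagonal responses never exceed the iterated limit
  (door E1c of the cell: bounded TOTAL source, the price moved into the `L → ∞` floor).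

## What is NOT here (honest scope)
Nothing asserts `HasDWaveOrderTT'` at any `(t', U, μ)`; no relation to finite-volume long-range order
(Koma–Tasaki's Conj. 2.10 direction is the barrier `SourcedOrderWithoutGroundStateLRO`); the ground states are
translation-invariant mean-energy minimisers, not arbitrary infinite-volume ground states; a certified window on
`E` still bounds `m*` from above only.

## References
* T. Koma, H. Tasaki, J. Stat. Phys. 76 (1994) 745–803, §1 and §2.4. [cite: KomaTasaki1994, §1]
* O. Bratteli, A. Kishimoto, D. W. Robinson, CMP 64 (1978) 41, Thm. 2. [cite: BratteliKishimotoRobinson1978, Thm. 2]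
* R. B. Griffiths, Phys. Rev. 152 (1966) 240, §II. [cite: Griffiths1966, §II]
-/

noncomputable section

namespace Literature.MathematicalPhysics.QuantumLattice

open _root_.Matrix Finset HubbardWave0 Literature.Probability.LatticeModels _root_.Filter Set
open scoped _root_.Topology ComplexOrder

/-! ### §4 At zero field: the quasi-average state and the order parameter -/

section ZeroField

variable {t' U μ : ℝ} {ω : InfVolFermionState 2}

/-- **Every translation-invariant ground state of the grand-canonical `t–t'` Hubbard interaction has `d`-wave
pair amplitude at most the order parameter**: `Re ω(P₀^d) ≤ dWaveOrderParameterTT' t' U μ`.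
[cite: KomaTasaki1994, §1] -/
theorem InfVolFermionState.IsMeanEnergyMinimiser.re_expect_localPairAt_le_dWaveOrderParameterTT'
    (hω : ω.IsMeanEnergyMinimiser (hubbardTTPrimeMuInteraction 1 t' U μ) 1) :
    (ω.expect (pairRegion (insert (0 : Site 2) unitSteps) 0)
        (localPairAt (insert 0 unitSteps) dWaveFormFactor 0)).re ≤ dWaveOrderParameterTT' t' U μ := by
  rw [← hubbardTTPrimeSourcedInteraction_zero_source 1 t' U μ dWaveFormFactor] at hω
  have hmem := hω.two_mul_re_expect_localPairAt_mem_Icc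
  rw [dWaveOrderParameterTT'_eq_neg_half_rightDeriv]
  linarith [hmem.2]

/-- … and at least MINUS the left-derivative bound: `−∂⁻E(0) ≤ 2 Re ω(P₀^d)`. [cite: KomaTasaki1994, §1] -/
theorem InfVolFermionState.IsMeanEnergyMinimiser.neg_leftDeriv_le_two_mul_re_expect_localPairAt
    (hω : ω.IsMeanEnergyMinimiser (hubbardTTPrimeMuInteraction 1 t' U μ) 1) :
    -derivWithin (dWaveSourceEnergyDensityTT' t' U μ) (Iio 0) 0 ≤
      2 * (ω.expect (pairRegion (insert (0 : Site 2) unitSteps) 0)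
        (localPairAt (insert 0 unitSteps) dWaveFormFactor 0)).re := by
  rw [← hubbardTTPrimeSourcedInteraction_zero_source 1 t' U μ dWaveFormFactor] at hω
  exact hω.two_mul_re_expect_localPairAt_mem_Icc.1

variable (t' U μ)

/-- **THE QUASI-AVERAGE STATE EXISTS**: some translation-invariant infinite-volume ground state of the
grand-canonical `t–t'` Hubbard interaction has `d`-wave pair amplitude EXACTLY the order parameter,
`Re ω(P₀^d) = dWaveOrderParameterTT' t' U μ` — the weak-⋆ limit `h → 0⁺` (after `L → ∞`) of sourced
translation-invariant ground states (Koma–Tasaki 1994 §1, §2.4). [cite: KomaTasaki1994, §1] -/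
theorem exists_isMeanEnergyMinimiser_re_expect_localPairAt_eq_dWaveOrderParameterTT' :
    ∃ ω : InfVolFermionState 2, ω.IsMeanEnergyMinimiser (hubbardTTPrimeMuInteraction 1 t' U μ) 1 ∧
      (ω.expect (pairRegion (insert (0 : Site 2) unitSteps) 0)
        (localPairAt (insert 0 unitSteps) dWaveFormFactor 0)).re = dWaveOrderParameterTT' t' U μ := by
  obtain ⟨ω, hω, hωe⟩ :=
    exists_isMeanEnergyMinimiser_two_mul_re_expect_localPairAt_eq_neg_rightDeriv t' U μ 0
  rw [hubbardTTPrimeSourcedInteraction_zero_source] at hω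
  refine ⟨ω, hω, ?_⟩
  rw [dWaveOrderParameterTT'_eq_neg_half_rightDeriv]
  linarith

/-- **The order parameter is the GREATEST `d`-wave pair amplitude of a translation-invariant ground state.**
[cite: KomaTasaki1994, §1] -/
theorem isGreatest_re_expect_localPairAt_groundStates_dWaveOrderParameterTT' :
    IsGreatest ((fun ω : InfVolFermionState 2 => (ω.expect (pairRegion (insert (0 : Site 2) unitSteps) 0)
        (localPairAt (insert 0 unitSteps) dWaveFormFactor 0)).re) ''
        {ω | ω.IsMeanEnergyMinimiser (hubbardTTPrimeMuInteraction 1 t' U μ) 1})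
      (dWaveOrderParameterTT' t' U μ) := by
  obtain ⟨ω, hω, hωe⟩ := exists_isMeanEnergyMinimiser_re_expect_localPairAt_eq_dWaveOrderParameterTT' t' U μ
  refine ⟨⟨ω, hω, hωe⟩, ?_⟩
  rintro _ ⟨ω', hω', rfl⟩
  exact hω'.re_expect_localPairAt_le_dWaveOrderParameterTT'

/-- **`d`-WAVE ORDER ⟺ A TRANSLATION-INVARIANT INFINITE-VOLUME GROUND STATE WITH NON-ZERO `d`-WAVE PAIR
AMPLITUDE EXISTS** (the cell's T2 word, literal): `HasDWaveOrderTT' t' U μ ↔ ∃ ω`, mean-energy minimiser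
of `hubbardTTPrimeMuInteraction 1 t' U μ`, with `0 < Re ω(P₀^d)`. [cite: KomaTasaki1994, §1] -/
theorem hasDWaveOrderTT'_iff_exists_isMeanEnergyMinimiser :
    HasDWaveOrderTT' t' U μ ↔ ∃ ω : InfVolFermionState 2,
      ω.IsMeanEnergyMinimiser (hubbardTTPrimeMuInteraction 1 t' U μ) 1 ∧
        0 < (ω.expect (pairRegion (insert (0 : Site 2) unitSteps) 0)
          (localPairAt (insert 0 unitSteps) dWaveFormFactor 0)).re := by
  rw [HasDWaveOrderTT']
  constructor
  · intro hpos
    obtain ⟨ω, hω, hωe⟩ := exists_isMeanEnergyMinimiser_re_expect_localPairAt_eq_dWaveOrderParameterTT' t' U μ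
    exact ⟨ω, hω, hωe ▸ hpos⟩
  · rintro ⟨ω, hω, hpos⟩
    exact hpos.trans_le hω.re_expect_localPairAt_le_dWaveOrderParameterTT'

/-- **`t' = 0`**: `HasDWaveOrder U μ ↔` some translation-invariant infinite-volume ground state of the
grand-canonical Hubbard interaction `hubbardTTPrimeMuInteraction 1 0 U μ` has `0 < Re ω(P₀^d)`.
[cite: KomaTasaki1994, §1] -/
theorem hasDWaveOrder_iff_exists_isMeanEnergyMinimiser (U μ : ℝ) :
    HasDWaveOrder U μ ↔ ∃ ω : InfVolFermionState 2,
      ω.IsMeanEnergyMinimiser (hubbardTTPrimeMuInteraction 1 0 U μ) 1 ∧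
        0 < (ω.expect (pairRegion (insert (0 : Site 2) unitSteps) 0)
          (localPairAt (insert 0 unitSteps) dWaveFormFactor 0)).re := by
  rw [← hasDWaveOrderTT'_zero_iff, hasDWaveOrderTT'_iff_exists_isMeanEnergyMinimiser]

/-- **`t' = 0`**: `dWaveOrderParameter U μ` is the greatest `d`-wave pair amplitude of a translation-invariant
ground state of `hubbardTTPrimeMuInteraction 1 0 U μ`. [cite: KomaTasaki1994, §1] -/
theorem isGreatest_re_expect_localPairAt_groundStates_dWaveOrderParameter (U μ : ℝ) :
    IsGreatest ((fun ω : InfVolFermionState 2 => (ω.expect (pairRegion (insert (0 : Site 2) unitSteps) 0)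
        (localPairAt (insert 0 unitSteps) dWaveFormFactor 0)).re) ''
        {ω | ω.IsMeanEnergyMinimiser (hubbardTTPrimeMuInteraction 1 0 U μ) 1})
      (dWaveOrderParameter U μ) := by
  rw [← dWaveOrderParameterTT'_zero]
  exact isGreatest_re_expect_localPairAt_groundStates_dWaveOrderParameterTT' 0 U μ

end ZeroField

/-! ### §4b Torus limits of finite-volume ground-state vectors at zero field -/

section TorusLimits

variable {ψ : ∀ L, Fock (Orb (FermionTorus 2 L))} {Ls : ℕ → ℕ} {ω : InfVolFermionState 2}

/-- **Torus limits of source-FREE grand-canonical ground-state vectors have `d`-wave amplitude at most the order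
parameter**: if `ω` is a torus limit (along `Ls → ∞`) of unit ground-state vectors of
`dWaveSourceTorusTT' L t' U μ 0 = H(1,t',U) − μN`, then `Re ω(P₀^d) ≤ dWaveOrderParameterTT' t' U μ` — such a
limit is a mean-energy minimiser (obsth-2's `IsTorusLimitOf.isMeanEnergyMinimiser_sourced`,
`DWaveSourceEnergyDensityEnsembles.lean`), so §4 applies. [cite: KomaTasaki1994, §1] -/
theorem InfVolFermionState.IsTorusLimitOf.re_expect_localPairAt_le_dWaveOrderParameterTT'
    [hL0 : ∀ j, NeZero (Ls j)] (hω : ω.IsTorusLimitOf ψ Ls) (hLs : Tendsto Ls atTop atTop)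
    (hψ : ∀ j, star (ψ (Ls j)) ⬝ᵥ ψ (Ls j) = 1) (t' U μ : ℝ)
    (hgs : ∀ j, dWaveSourceTorusTT' (Ls j) t' U μ 0 *ᵥ ψ (Ls j) =
      ((Matrix.groundEnergy (dWaveSourceTorusTT' (Ls j) t' U μ 0) : ℝ) : ℂ) • ψ (Ls j)) :
    (ω.expect (pairRegion (insert (0 : Site 2) unitSteps) 0)
        (localPairAt (insert 0 unitSteps) dWaveFormFactor 0)).re ≤ dWaveOrderParameterTT' t' U μ := by
  have hmin := hω.isMeanEnergyMinimiser_sourced hLs hψ t' U μ 0 hgs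
  rw [hubbardTTPrimeSourcedInteraction_zero_source] at hmin
  exact hmin.re_expect_localPairAt_le_dWaveOrderParameterTT'

end TorusLimits

/-! ### §5 Diagonal (vanishing-source) sequences floor the order parameter from below — never exceed it -/

section Diagonal

/-- **Bounded-total-source transfer** (hubbard-pc-lens-finite-1): a floor `ε ≤ liminf_L m_{L+1}(h_L)` on the
sourced torus densities along ANY positive source sequence `h_L → 0` floors the order parameter,
`ε ≤ dWaveOrderParameterTT' t' U μ` (monotonicity of `h ↦ m_L(h)` and the staircase form of `m*`; no
modulus of continuity in `h` is used — the price sits in the `L → ∞` floor). [cite: KomaTasaki1994, §1] -/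
theorem le_dWaveOrderParameterTT'_of_vanishing_source (t' U μ ε : ℝ) (hs : ℕ → ℝ)
    (hpos : ∀ L, 0 < hs L) (hlim : Tendsto hs atTop (𝓝 0))
    (H : ε ≤ liminf (fun L : ℕ => dWaveSourceDensityTT' (L + 1) t' U μ (hs L)) atTop) :
    ε ≤ dWaveOrderParameterTT' t' U μ := by
  rw [le_dWaveOrderParameterTT'_iff_forall]
  intro h hh
  refine H.trans ?_
  have hev : ∀ᶠ L in atTop, hs L ≤ h := hlim.eventually (eventually_le_nhds hh)
  refine liminf_le_liminf ?_ ?_ ?_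
  · filter_upwards [hev] with L hL using dWaveSourceDensityTT'_mono t' U μ hL
  · exact isBoundedUnder_of_eventually_ge (a := 0)
      (Eventually.of_forall fun L => dWaveSourceDensityTT'_nonneg t' U μ (hpos L).le)
  · exact isCoboundedUnder_ge_of_eventually_le atTop
      (x := 2 * ∑ e ∈ insert (0 : Site 2) unitSteps, |dWaveFormFactor e / Real.sqrt 2|)
      (Eventually.of_forall fun L => dWaveSourceDensityTT'_le_const _ t' U μ h)

/-- **`t' = 0`** (hubbard-pc-lens-finite-1, verbatim up to namespace): `ε ≤ liminf_L m_{L+1}(h_L)` with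
`h_L → 0⁺` implies `ε ≤ dWaveOrderParameter U μ`. [cite: KomaTasaki1994, §1] -/
theorem le_dWaveOrderParameter_of_vanishing_source (U μ ε : ℝ) (hs : ℕ → ℝ)
    (hpos : ∀ L, 0 < hs L) (hlim : Tendsto hs atTop (𝓝 0))
    (H : ε ≤ liminf (fun L : ℕ => dWaveSourceDensity (L + 1) U μ (hs L)) atTop) :
    ε ≤ dWaveOrderParameter U μ := by
  rw [← dWaveOrderParameterTT'_zero]
  refine le_dWaveOrderParameterTT'_of_vanishing_source 0 U μ ε hs hpos hlim ?_
  simpa only [dWaveSourceDensityTT'_zero] using H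

/-- The `λ₀/(L+1)²` instance (total source `O(1)`, door E1c of the cell): a certified floor
`ε ≤ m_{L+1}(λ₀/(L+1)²)` for all large `L` floors `dWaveOrderParameter U μ`. [cite: KomaTasaki1994, §1] -/
theorem le_dWaveOrderParameter_of_inverseSquare_source (U μ ε lam : ℝ) (hlam : 0 < lam)
    (H : ε ≤ liminf (fun L : ℕ => dWaveSourceDensity (L + 1) U μ (lam / ((L : ℝ) + 1) ^ 2)) atTop) :
    ε ≤ dWaveOrderParameter U μ := by
  refine le_dWaveOrderParameter_of_vanishing_source U μ ε (fun L => lam / ((L : ℝ) + 1) ^ 2)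
    (fun L => by positivity) ?_ H
  have h1 : Tendsto (fun L : ℕ => ((L : ℝ) + 1) ^ 2) atTop atTop := by
    have h0 : Tendsto (fun L : ℕ => (L : ℝ) + 1) atTop atTop :=
      tendsto_natCast_atTop_atTop.atTop_add tendsto_const_nhds
    exact (tendsto_pow_atTop two_ne_zero).comp h0
  simpa using tendsto_const_nhds.div_atTop h1

end Diagonal

end Literature.MathematicalPhysics.QuantumLattice

end
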